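import Summits.Ventures.HodgeRepro2.T5RecordSphericalSpectrumInertToy

/-!
# The unramified spectrum at `(3)` of `ℚ(i)` with the structures of `ℚ(ζ₄)` supplied

Tier-5 support N3 / §G-N4.2 (seat p3, gen 86). File 345 states file 344's unramified-spectrum theorem at the inert
place `(3)` of `L = ℚ(ζ₄) = ℚ(i)` with `q' = 3` and the explicit datum `(θ, y) = (−1, ζ₄)`, under the section
instances `[NumberField L] [IsCMField L]`. This file supplies those instances inside the statements (file 238's
`numberField L`, p8's `isCMField_four L`), so that no hypothesis on `L` remains beyond
`IsCyclotomicExtension {4} ℚ L`: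

* **`exists_mulEquiv_forall_nonempty_equiv_inertSphericalQuot_record_three_zeta_concrete`** — for any generators
  `l` of `𝓞_{ℚ(i)}` over `𝓞_{ℚ(i)⁺}`: `u₀`, `Φ : U(J₃(u₀)) ≃* U(1 ⊗ H₀)`, a star-fixed uniformiser `ϖ'`, and every
  irreducible `K_{(3)}`-finite representation of `U(1 ⊗ H₀)` with non-zero finite-dimensional `K_{(3)}`-invariants
  `≅ (inertSphericalQuot (α · (3²)⁻¹)) ∘ Φ⁻¹` for some `α ≠ 0`;
* **`exists_generators_and_…_concrete`** — with the generators supplied (file 235): the whole hypothesis set of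
  file 344's statement is inhabited on any fourth cyclotomic extension of `ℚ` at `3`.

Lean note of record: the statements carry the instances as `haveI`; the proofs must pass the instance terms
EXPLICITLY (`@… L _ _ _ (numberField L) (isCMField_four L) …`, file 249's pattern) — the same proof through
instance synthesis exceeds the default heartbeat budget at `whnf`, while the statement alone elaborates in 4 s.

§8(d): uses an L-value-free non-vanishing device: NO.
-/

open Matrix NumberField NumberField.IsCMField IsDedekindDomain IsDedekindDomain.HeightOneSpectrum Module
  MulAction
open scoped TensorProduct Pointwise
open Summit.Ventures.HodgeRepro2.T5UnitaryGroupForm Summit.Ventures.HodgeRepro2.T5UnitaryHeckeAdjoint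
  Summit.Ventures.HodgeRepro2.T5HeckePermutationModule Summit.Ventures.HodgeRepro2.LevelPositivity
  Summit.Ventures.HodgeRepro2.T5LevelIdempotent Summit.Ventures.HodgeRepro2.T5StarOfInvolution
  Summit.Ventures.HodgeRepro2.T5FinitePlaceCM Summit.Ventures.HodgeRepro2.T5NonSplitPlaceUnitaryGroup
  Summit.Ventures.HodgeRepro2.T5RecordHyperspecial Summit.Ventures.HodgeRepro2.T5GlobalLatticeAlmostAll
  Summit.Ventures.HodgeRepro2.T5HermitianThreeElements Summit.Ventures.HodgeRepro2.T5GaloisCartanThree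
  Summit.Ventures.HodgeRepro2.T5InertDegreeGalois Summit.Ventures.HodgeRepro2.T5InertPlaceCompletion
  Summit.Ventures.HodgeRepro2.T5InertDegreeAdicCompletion Summit.Ventures.HodgeRepro2.T5InertSatakeTransform
  Summit.Ventures.HodgeRepro2.T5InertSatakeTransformCompletion Summit.Ventures.HodgeRepro2.T5InertUnipotentResidue
  Summit.Ventures.HodgeRepro2.T5InertSphericalSubquotient Summit.Ventures.HodgeRepro2.T5RecordSatakeCell
  Summit.Ventures.HodgeRepro2.T5SplitPlaceUnitaryGroup Summit.Ventures.HodgeRepro2.T5FinitePlaceNormIndex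
  Summit.Ventures.HodgeRepro2.T5HermitianLocalIsotropyN3 Summit.Ventures.HodgeRepro2.T5FinitePlaceSplitClassification
  Summit.Ventures.HodgeRepro2.T5InertDegreeCompletion Summit.Ventures.HodgeRepro2.T5InertPlaceCompletionCells
  Summit.Ventures.HodgeRepro2.T5RecordSatake Summit.Ventures.HodgeRepro2.T5CartanCellsDistinct
  Summit.Ventures.HodgeRepro2.T5RecordSatakeInert Summit.Ventures.HodgeRepro2.T5InertGlobalPrime
  Summit.Ventures.HodgeRepro2.T5CMFieldSquareDatum Summit.Ventures.HodgeRepro2.T5RecordSatakeDegree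
  Summit.Ventures.HodgeRepro2.T5RecordSatakeDegreeIntrinsic Summit.Ventures.HodgeRepro2.T5RecordSphericalSpectrum
  Summit.Ventures.HodgeRepro2.T5RecordSphericalSpectrumIntrinsic Summit.Ventures.HodgeRepro2.T5RecordSatakeToy
  Summit.Ventures.HodgeRepro2.T5RecordSatakeInertToy Summit.Ventures.HodgeRepro2.T5RecordSatakeInertToyDegree
  Summit.Ventures.HodgeRepro2.T5CMCensusToy Summit.Ventures.HodgeRepro2.T5RecordSphericalSpectrumInertToy

namespace Summit.Ventures.HodgeRepro2.T5RecordSphericalSpectrumInertToyConcrete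

universe uV

section Concrete

variable (L : Type*) [Field L] [CharZero L] [IsCyclotomicExtension {2 ^ 2} ℚ L]
variable {r : ℕ} (l : Fin r → 𝓞 L) (k : Type*) [Field k] [CharZero k] [IsAlgClosed k]

/-- The explicit-datum statement with the number-field and CM-field structures of `ℚ(ζ₄)` supplied
(`numberField L`, `isCMField_four L`) — no instance hypothesis on `L` beyond `IsCyclotomicExtension {4} ℚ L`. -/
theorem exists_mulEquiv_forall_nonempty_equiv_inertSphericalQuot_record_three_zeta_concrete
    (hl : Submodule.span (𝓞 (maximalRealSubfield L)) (Set.range l) = ⊤) :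
    haveI := numberField L; haveI := isCMField_four L
    letI := tensorStarRing L (vThreePlus L)
    letI := starRingOfQuadratic (finrank_eq_two L (vThreePlus L) (T5InertPrimeToy.wThree L) (neg_one_eq_zeta_sq L) (complexConj_zeta_ne L)
        (not_isSquare_of_staysPrime L (vThreePlus L) (T5InertPrimeToy.wThree L) (neg_one_eq_zeta_sq L) (complexConj_zeta_ne L) (map_vThreePlus L)))
      (localConj (vThreePlus L) (T5InertPrimeToy.wThree L) (neg_one_eq_zeta_sq L).symm (span_pair_eq_top L (complexConj_zeta_ne L))
        (not_isSquare_of_staysPrime L (vThreePlus L) (T5InertPrimeToy.wThree L) (neg_one_eq_zeta_sq L) (complexConj_zeta_ne L) (map_vThreePlus L))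
        (complexConj L))
      (localConj_ne_one (vThreePlus L) (T5InertPrimeToy.wThree L) (neg_one_eq_zeta_sq L).symm (span_pair_eq_top L (complexConj_zeta_ne L))
        (not_isSquare_of_staysPrime L (vThreePlus L) (T5InertPrimeToy.wThree L) (neg_one_eq_zeta_sq L) (complexConj_zeta_ne L) (map_vThreePlus L))
        (complexConj L) (complexConj_apply_eq_neg L (neg_one_eq_zeta_sq L) (complexConj_zeta_ne L)))
    haveI := isDiscreteValuationRing_integralClosure_adicCompletion (vThreePlus L) (T5InertPrimeToy.wThree L)
    haveI := finite_residueField_integralClosure_adicCompletion (vThreePlus L) (T5InertPrimeToy.wThree L)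
    haveI : IsFractionRing (integralClosure ((vThreePlus L).adicCompletionIntegers (maximalRealSubfield L))
        ((T5InertPrimeToy.wThree L).adicCompletion L)) ((T5InertPrimeToy.wThree L).adicCompletion L) :=
      integralClosure.isFractionRing_of_finite_extension ((vThreePlus L).adicCompletion (maximalRealSubfield L))
        ((T5InertPrimeToy.wThree L).adicCompletion L)
    ∃ (u₀ : ((vThreePlus L).adicCompletionIntegers (maximalRealSubfield L))ˣ)
      (Φ : ↥(formUnitaryGroup (J3 (algebraMap ((vThreePlus L).adicCompletionIntegers (maximalRealSubfield L))
        ((T5InertPrimeToy.wThree L).adicCompletion L)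
        (u₀ : (vThreePlus L).adicCompletionIntegers (maximalRealSubfield L))))) ≃*
        ↥(formUnitaryGroup (tensorGram L (vThreePlus L) (gramToy L))))
      (ϖ' : integralClosure ((vThreePlus L).adicCompletionIntegers (maximalRealSubfield L))
        ((T5InertPrimeToy.wThree L).adicCompletion L))
      (hϖ' : Irreducible ϖ')
      (hs' : star (algebraMap (integralClosure ((vThreePlus L).adicCompletionIntegers (maximalRealSubfield L))
        ((T5InertPrimeToy.wThree L).adicCompletion L)) ((T5InertPrimeToy.wThree L).adicCompletion L) ϖ') =
          algebraMap (integralClosure ((vThreePlus L).adicCompletionIntegers (maximalRealSubfield L))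
            ((T5InertPrimeToy.wThree L).adicCompletion L)) ((T5InertPrimeToy.wThree L).adicCompletion L) ϖ'),
      (∀ g, g ∈ hyperspecialSubgroup
          (integralClosure ((vThreePlus L).adicCompletionIntegers (maximalRealSubfield L))
            ((T5InertPrimeToy.wThree L).adicCompletion L))
          (J3 (algebraMap ((vThreePlus L).adicCompletionIntegers (maximalRealSubfield L))
            ((T5InertPrimeToy.wThree L).adicCompletion L)
            (u₀ : (vThreePlus L).adicCompletionIntegers (maximalRealSubfield L)))) ↔
          Φ g ∈ recordHyperspecial L (vThreePlus L) l (gramToy L)) ∧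
      ∀ {V : Type uV} [AddCommGroup V] [Module k V]
        (ρ : Representation k (↥(formUnitaryGroup (tensorGram L (vThreePlus L) (gramToy L)))) V) [ρ.IsIrreducible],
        KFinite ρ (recordHyperspecial L (vThreePlus L) l (gramToy L)) →
        ∀ [FiniteDimensional k (invariants ρ (recordHyperspecial L (vThreePlus L) l (gramToy L)))],
        invariants ρ (recordHyperspecial L (vThreePlus L) l (gramToy L)) ≠ ⊥ →
        ∃ α : k, α ≠ 0 ∧ Nonempty (ρ.Equiv (comp Φ.symm
          (inertSphericalQuot
            (hstar_of_star_eq (localConj (vThreePlus L) (T5InertPrimeToy.wThree L) (neg_one_eq_zeta_sq L).symm (span_pair_eq_top L (complexConj_zeta_ne L))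
              (not_isSquare_of_staysPrime L (vThreePlus L) (T5InertPrimeToy.wThree L) (neg_one_eq_zeta_sq L) (complexConj_zeta_ne L) (map_vThreePlus L))
              (complexConj L))
              (fun x => by
                rw [star_p8_eq_star L (vThreePlus L) (T5InertPrimeToy.wThree L) (neg_one_eq_zeta_sq L) (complexConj_zeta_ne L)
                  (not_isSquare_of_staysPrime L (vThreePlus L) (T5InertPrimeToy.wThree L) (neg_one_eq_zeta_sq L) (complexConj_zeta_ne L)
                    (map_vThreePlus L))]
                rfl))
            (algebraMap ((vThreePlus L).adicCompletionIntegers (maximalRealSubfield L))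
              ((T5InertPrimeToy.wThree L).adicCompletion L)
              (u₀ : (vThreePlus L).adicCompletionIntegers (maximalRealSubfield L)))
            (star_algebraMap_of_star_eq (localConj (vThreePlus L) (T5InertPrimeToy.wThree L) (neg_one_eq_zeta_sq L).symm
              (span_pair_eq_top L (complexConj_zeta_ne L))
              (not_isSquare_of_staysPrime L (vThreePlus L) (T5InertPrimeToy.wThree L) (neg_one_eq_zeta_sq L) (complexConj_zeta_ne L) (map_vThreePlus L))
              (complexConj L))
              (fun x => by
                rw [star_p8_eq_star L (vThreePlus L) (T5InertPrimeToy.wThree L) (neg_one_eq_zeta_sq L) (complexConj_zeta_ne L)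
                  (not_isSquare_of_staysPrime L (vThreePlus L) (T5InertPrimeToy.wThree L) (neg_one_eq_zeta_sq L) (complexConj_zeta_ne L)
                    (map_vThreePlus L))]
                rfl)
              (u₀ : (vThreePlus L).adicCompletionIntegers (maximalRealSubfield L)))
            (algebraMap_unit_ne_zero (F := (vThreePlus L).adicCompletion (maximalRealSubfield L)) u₀)
            (isInteger_algebraMap (u₀ : (vThreePlus L).adicCompletionIntegers (maximalRealSubfield L)))
            (isInteger_algebraMap_unit_inv u₀) hϖ' hs' k (α * ((3 : k) ^ 2)⁻¹)))) :=
  @exists_mulEquiv_forall_nonempty_equiv_inertSphericalQuot_record_three_zeta L _ _ _ (numberField L)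
    (isCMField_four L) r l k _ _ _ hl

/-- The generators-supplied statement with the number-field and CM-field structures of `ℚ(ζ₄)` supplied: the whole
hypothesis set of file 344's statement is inhabited on any fourth cyclotomic extension `L` of `ℚ` at `3`. -/
theorem exists_generators_and_mulEquiv_forall_nonempty_equiv_inertSphericalQuot_record_three_zeta_concrete :
    haveI := numberField L; haveI := isCMField_four L
    ∃ (r : ℕ) (l : Fin r → 𝓞 L), Submodule.span (𝓞 (maximalRealSubfield L)) (Set.range l) = ⊤ ∧
      (letI := tensorStarRing L (vThreePlus L)
      letI := starRingOfQuadratic (finrank_eq_two L (vThreePlus L) (T5InertPrimeToy.wThree L) (neg_one_eq_zeta_sq L) (complexConj_zeta_ne L)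
          (not_isSquare_of_staysPrime L (vThreePlus L) (T5InertPrimeToy.wThree L) (neg_one_eq_zeta_sq L) (complexConj_zeta_ne L) (map_vThreePlus L)))
        (localConj (vThreePlus L) (T5InertPrimeToy.wThree L) (neg_one_eq_zeta_sq L).symm (span_pair_eq_top L (complexConj_zeta_ne L))
          (not_isSquare_of_staysPrime L (vThreePlus L) (T5InertPrimeToy.wThree L) (neg_one_eq_zeta_sq L) (complexConj_zeta_ne L) (map_vThreePlus L))
          (complexConj L))
        (localConj_ne_one (vThreePlus L) (T5InertPrimeToy.wThree L) (neg_one_eq_zeta_sq L).symm (span_pair_eq_top L (complexConj_zeta_ne L))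
          (not_isSquare_of_staysPrime L (vThreePlus L) (T5InertPrimeToy.wThree L) (neg_one_eq_zeta_sq L) (complexConj_zeta_ne L) (map_vThreePlus L))
          (complexConj L) (complexConj_apply_eq_neg L (neg_one_eq_zeta_sq L) (complexConj_zeta_ne L)))
      haveI := isDiscreteValuationRing_integralClosure_adicCompletion (vThreePlus L) (T5InertPrimeToy.wThree L)
      haveI := finite_residueField_integralClosure_adicCompletion (vThreePlus L) (T5InertPrimeToy.wThree L)
      haveI : IsFractionRing (integralClosure ((vThreePlus L).adicCompletionIntegers (maximalRealSubfield L))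
          ((T5InertPrimeToy.wThree L).adicCompletion L)) ((T5InertPrimeToy.wThree L).adicCompletion L) :=
        integralClosure.isFractionRing_of_finite_extension ((vThreePlus L).adicCompletion (maximalRealSubfield L))
          ((T5InertPrimeToy.wThree L).adicCompletion L)
      ∃ (u₀ : ((vThreePlus L).adicCompletionIntegers (maximalRealSubfield L))ˣ)
        (Φ : ↥(formUnitaryGroup (J3 (algebraMap ((vThreePlus L).adicCompletionIntegers (maximalRealSubfield L))
          ((T5InertPrimeToy.wThree L).adicCompletion L)
          (u₀ : (vThreePlus L).adicCompletionIntegers (maximalRealSubfield L))))) ≃*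
          ↥(formUnitaryGroup (tensorGram L (vThreePlus L) (gramToy L))))
        (ϖ' : integralClosure ((vThreePlus L).adicCompletionIntegers (maximalRealSubfield L))
          ((T5InertPrimeToy.wThree L).adicCompletion L))
        (hϖ' : Irreducible ϖ')
        (hs' : star (algebraMap (integralClosure ((vThreePlus L).adicCompletionIntegers (maximalRealSubfield L))
          ((T5InertPrimeToy.wThree L).adicCompletion L)) ((T5InertPrimeToy.wThree L).adicCompletion L) ϖ') =
            algebraMap (integralClosure ((vThreePlus L).adicCompletionIntegers (maximalRealSubfield L))
              ((T5InertPrimeToy.wThree L).adicCompletion L)) ((T5InertPrimeToy.wThree L).adicCompletion L) ϖ'),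
        (∀ g, g ∈ hyperspecialSubgroup
            (integralClosure ((vThreePlus L).adicCompletionIntegers (maximalRealSubfield L))
              ((T5InertPrimeToy.wThree L).adicCompletion L))
            (J3 (algebraMap ((vThreePlus L).adicCompletionIntegers (maximalRealSubfield L))
              ((T5InertPrimeToy.wThree L).adicCompletion L)
              (u₀ : (vThreePlus L).adicCompletionIntegers (maximalRealSubfield L)))) ↔
            Φ g ∈ recordHyperspecial L (vThreePlus L) l (gramToy L)) ∧
        ∀ {V : Type uV} [AddCommGroup V] [Module k V]
          (ρ : Representation k (↥(formUnitaryGroup (tensorGram L (vThreePlus L) (gramToy L)))) V) [ρ.IsIrreducible],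
          KFinite ρ (recordHyperspecial L (vThreePlus L) l (gramToy L)) →
          ∀ [FiniteDimensional k (invariants ρ (recordHyperspecial L (vThreePlus L) l (gramToy L)))],
          invariants ρ (recordHyperspecial L (vThreePlus L) l (gramToy L)) ≠ ⊥ →
          ∃ α : k, α ≠ 0 ∧ Nonempty (ρ.Equiv (comp Φ.symm
            (inertSphericalQuot
              (hstar_of_star_eq (localConj (vThreePlus L) (T5InertPrimeToy.wThree L) (neg_one_eq_zeta_sq L).symm (span_pair_eq_top L (complexConj_zeta_ne L))
                (not_isSquare_of_staysPrime L (vThreePlus L) (T5InertPrimeToy.wThree L) (neg_one_eq_zeta_sq L) (complexConj_zeta_ne L) (map_vThreePlus L))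
                (complexConj L))
                (fun x => by
                  rw [star_p8_eq_star L (vThreePlus L) (T5InertPrimeToy.wThree L) (neg_one_eq_zeta_sq L) (complexConj_zeta_ne L)
                    (not_isSquare_of_staysPrime L (vThreePlus L) (T5InertPrimeToy.wThree L) (neg_one_eq_zeta_sq L) (complexConj_zeta_ne L)
                      (map_vThreePlus L))]
                  rfl))
              (algebraMap ((vThreePlus L).adicCompletionIntegers (maximalRealSubfield L))
                ((T5InertPrimeToy.wThree L).adicCompletion L)
                (u₀ : (vThreePlus L).adicCompletionIntegers (maximalRealSubfield L)))
              (star_algebraMap_of_star_eq (localConj (vThreePlus L) (T5InertPrimeToy.wThree L) (neg_one_eq_zeta_sq L).symm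
                (span_pair_eq_top L (complexConj_zeta_ne L))
                (not_isSquare_of_staysPrime L (vThreePlus L) (T5InertPrimeToy.wThree L) (neg_one_eq_zeta_sq L) (complexConj_zeta_ne L) (map_vThreePlus L))
                (complexConj L))
                (fun x => by
                  rw [star_p8_eq_star L (vThreePlus L) (T5InertPrimeToy.wThree L) (neg_one_eq_zeta_sq L) (complexConj_zeta_ne L)
                    (not_isSquare_of_staysPrime L (vThreePlus L) (T5InertPrimeToy.wThree L) (neg_one_eq_zeta_sq L) (complexConj_zeta_ne L)
                      (map_vThreePlus L))]
                  rfl)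
                (u₀ : (vThreePlus L).adicCompletionIntegers (maximalRealSubfield L)))
              (algebraMap_unit_ne_zero (F := (vThreePlus L).adicCompletion (maximalRealSubfield L)) u₀)
              (isInteger_algebraMap (u₀ : (vThreePlus L).adicCompletionIntegers (maximalRealSubfield L)))
              (isInteger_algebraMap_unit_inv u₀) hϖ' hs' k (α * ((3 : k) ^ 2)⁻¹))))) :=
  @exists_generators_and_mulEquiv_forall_nonempty_equiv_inertSphericalQuot_record_three_zeta L _ _ _
    (numberField L) (isCMField_four L) k _ _ _

end Concrete

end Summit.Ventures.HodgeRepro2.T5RecordSphericalSpectrumInertToyConcrete
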